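import Mathlib
import Literature.Analysis.PDE.DAlembert1D
import HarnessLib

/-!
# d'Alembert's solution with `C^{n+2}` data is `C^{n+2}`

Analysis/PDE support file (everything proved). Regularity upgrade of
`Literature.Analysis.PDE.exists_dAlembert_solution`: for `h ∈ C^{n+2}`, `g ∈ C^{n+1}` the travelling-wave
solution `φ₀(t,x) = F(x−t) + G(x+t)` of `φ_tt = φ_xx` with data `(h, g)` has `F, G ∈ C^{n+2}` and
`uncurry φ₀ ∈ C^{n+2}` (`exists_dAlembert_solution_contDiff`). Derived from the `C²` statement: `F + G = h`
and `(G − F)' = g` force `G − F ∈ C^{n+2}`. Needed to feed `C^{ℓ+2}` free waves into the `ℓ`-fold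
intertwining ladder `∂ₓ − k/x` producing exact solutions of `ψ_tt − ψ_xx + ℓ(ℓ+1)x⁻²ψ = 0`
(route PhotonSphereChannels, `FixedModeChannels`, stmt-FinalStateConjecture-10048). Folklore.
-/

noncomputable section

namespace Literature.Analysis.PDE

open Set

/-- A differentiable function whose derivative is `C^{n}` is `C^{n+1}`. [folklore] -/
theorem contDiff_succ_of_deriv {u : ℝ → ℝ} {n : ℕ} (hu : Differentiable ℝ u)
    (hu' : ContDiff ℝ n (deriv u)) : ContDiff ℝ (n + 1) u := by
  rw [contDiff_succ_iff_deriv]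
  exact ⟨hu, fun h => absurd h (by simp), hu'⟩

/-- **d'Alembert with `C^{n+2}` data.** For `h ∈ C^{n+2}`, `g ∈ C^{n+1}` there are `F, G ∈ C^{n+2}`
and `φ₀(t,x) = F(x−t) + G(x+t)` with `uncurry φ₀ ∈ C^{n+2}`, `F + G = h`, `G' − F' = g`, solving
`φ_tt = φ_xx` with `φ₀(0,·) = h`, `∂ₜφ₀(0,·) = g`. [folklore] -/
theorem exists_dAlembert_solution_contDiff {h g : ℝ → ℝ} {n : ℕ} (hh : ContDiff ℝ (n + 2) h)
    (hg : ContDiff ℝ (n + 1) g) :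
    ∃ (φ₀ : ℝ → ℝ → ℝ) (F G : ℝ → ℝ),
      ContDiff ℝ (n + 2) (Function.uncurry φ₀) ∧ ContDiff ℝ (n + 2) F ∧ ContDiff ℝ (n + 2) G ∧
      (∀ t x, φ₀ t x = F (x - t) + G (x + t)) ∧
      (∀ x, F x + G x = h x) ∧ (∀ x, deriv G x - deriv F x = g x) ∧
      (∀ t x, iteratedDeriv 2 (fun τ => φ₀ τ x) t = iteratedDeriv 2 (φ₀ t) x) ∧
      (∀ x, φ₀ 0 x = h x) ∧ (∀ x, deriv (fun τ => φ₀ τ x) 0 = g x) ∧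
      (∀ t x, deriv (fun τ => φ₀ τ x) t = -deriv F (x - t) + deriv G (x + t)) ∧
      (∀ t x, deriv (φ₀ t) x = deriv F (x - t) + deriv G (x + t)) := by
  have hh2 : ContDiff ℝ 2 h := hh.of_le (by exact_mod_cast Nat.le_add_left 2 n)
  have hg1 : ContDiff ℝ 1 g := hg.of_le (by exact_mod_cast Nat.le_add_left 1 n)
  obtain ⟨φ₀, F, G, hφC2, hF2, hG2, hrep, hFG, hGF, -, -, hwave, hd0, hv0, hdt, hdx, -⟩ :=
    exists_dAlembert_solution hh2 hg1
  -- `G − F ∈ C^{n+2}`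
  have hFd : Differentiable ℝ F := hF2.differentiable (by norm_num)
  have hGd : Differentiable ℝ G := hG2.differentiable (by norm_num)
  have hdiff : ContDiff ℝ (n + 2) (fun x => G x - F x) := by
    have hder : deriv (fun x => G x - F x) = g := by
      funext x
      rw [deriv_fun_sub (hGd x) (hFd x), hGF x]
    have h1 : ContDiff ℝ (n + 1) (deriv fun x => G x - F x) := by rw [hder]; exact hg
    exact contDiff_succ_of_deriv (hGd.sub hFd) h1
  have hFn : ContDiff ℝ (n + 2) F := by
    have : F = fun x => (h x - (G x - F x)) / 2 := by
      funext x; have := hFG x; field_simp; linarith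
    rw [this]; exact (hh.sub hdiff).div_const 2
  have hGn : ContDiff ℝ (n + 2) G := by
    have : G = fun x => (h x + (G x - F x)) / 2 := by
      funext x; have := hFG x; field_simp; linarith
    rw [this]; exact (hh.add hdiff).div_const 2
  have hφn : ContDiff ℝ (n + 2) (Function.uncurry φ₀) := by
    have : Function.uncurry φ₀ = fun p : ℝ × ℝ => F (p.2 - p.1) + G (p.2 + p.1) := by
      funext p; exact hrep p.1 p.2
    rw [this]
    exact (hFn.comp (contDiff_snd.sub contDiff_fst)).add (hGn.comp (contDiff_snd.add contDiff_fst))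
  exact ⟨φ₀, F, G, hφn, hFn, hGn, hrep, hFG, hGF, hwave, hd0, hv0, hdt, hdx⟩

end Literature.Analysis.PDE
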